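import Literature.MathematicalPhysics.QuantumFieldTheory.Balaban1983to89.T4TermFormat

/-!
# T4FeltGeometry — the geometry of "felt at" behind `T4TermFormat.Booking.PositionalCount` / `BranchLocal`

Cell `pub-balaban` (audit and reconstruction of Bałaban's lattice Yang–Mills series; host summit YangMills; this
module is NOT summit progress and asserts NOTHING printed in the audited papers).  Row **T4-O3.E-iii-a.G\***
(self-proposed kernel row, journal CLAIM 2026-08-18T22:2xZ, SURGE NODE PROVER #16 gen 4): the located abstraction (1)
of GAPS G-pv16g4-8 — `T4TermFormat.Booking` leaves the geometry of "felt at" abstract and offers only its two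
counting shadows `PositionalCount N` (births of scale `j` felt at a `k`-cube ≤ `N j k`) and `BranchLocal m₀` (a birth
is felt at ≤ `m₀` cubes of each scale) as HYPOTHESES.  Here both are DISCHARGED, in the kernel, from an explicit
block-lattice anchoring: a birth of scale `j` carries a finite localisation DOMAIN of `j`-block coordinates in `ℕ^d`,
a cube of scale `k` carries a `k`-block coordinate, and "felt at" means "some block of the domain coarsens (by
`L^{k−j}` in each coordinate) to the cube's block".  Then
* `#{scale-j births felt at a k-cube} ≤ m · (L^d)^{k−j}` where `m` bounds the number of scale-`j` births whose
  domain contains a given `j`-block (`Booking.positionalCount_of_anchoring`) — exactly the count hypothesis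
  `hNle : N j k ≤ N₀·Λ^{k−j}` of `T4TermFormat.Booking.cubeBudget_of_twoRate` with `Λ = L^d`, `N₀ = m`;
* `#{k-cubes feeling a birth} ≤ |domain|` when cubes of one scale have distinct blocks
  (`Booking.branchLocal_of_anchoring`).
All of it is [folklore] finite combinatorics (fibres of the coarsening map are boxes of `(L^n)^d` points).

THE PRINTED ANCHORING this mirrors (context only; renders read AS IMAGES by this seat; the papers are under
adjudication and nothing in them is asserted here):
* [Balaban1988Convergent] B14 (CMP 119:243) p. 259 [render p017]: "E^{(j)}(Λ_j, U_k) = Σ_{z∈Λ⁰_j} E^{(j)}(Λ_j, U_k, z) ,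
  (2.26)  E^{(j)}(Λ_j, U_k, z) = Σ_{X∋z} E^{(j)}(X, U_k, z) , (2.27) where the last sum is over localization domains
  X∈D_j contained in Λ_j, X⊂Λ_j. The term E^{(j)}(X, U_k, z) of the last sum has the following properties: (i) it
  depends on U_k restricted to X;" — terms of birth scale `j` are anchored at points `z` of the `j`-lattice and carry a
  localisation domain `X ∋ z`.
* [Balaban1988RG2Cluster] B13 (CMP 116:1) p. 16 [render p016]: the bound (2.20) holds for the terms "resummed over all
  Y∈D_k containing, for example, the point b₋" (certified GAPS C-pv16g4-4) — the per-point resummation that makes a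
  per-block MULTIPLICITY `m` the right currency.
NOT typed / NOT claimed: any bound on `|X|` (domain sizes, `R_j`-type radii) or on `m` — they stay hypotheses
(`hdom`, `hmult`); that Bałaban's or the cell's D-terms are anchored this way (rows O3.E-iii-b, -iii-c decide their
instance); tori / boundary effects (coordinates live in `ℕ^d`; a torus of side `L^K` is the sub-box, and the count is
an upper bound either way).  Value = kernel bookkeeping discharging a typed hypothesis, NOT summit progress.
-/

namespace Literature.MathematicalPhysics.QuantumFieldTheory.Balaban1983to89.T4FeltGeometry

open Finset
open scoped BigOperators

/-! ## §1 Block arithmetic on `ℕ^d` -/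

/-- Coarsening by `n` scales with blocking factor `L`: the `n`-fold block coordinate of `y ∈ ℕ^d` is
`(y i / L^n)_i`. [folklore] -/
def coarsen (L n : ℕ) {d : ℕ} (y : Fin d → ℕ) : Fin d → ℕ := fun i => y i / L ^ n

/-- Coordinates of the coarsened block. [folklore] -/
@[simp] theorem coarsen_apply (L n : ℕ) {d : ℕ} (y : Fin d → ℕ) (i : Fin d) :
    coarsen L n y i = y i / L ^ n := rfl

/-- Zero-fold coarsening is the identity. [folklore] -/
@[simp] theorem coarsen_zero (L : ℕ) {d : ℕ} (y : Fin d → ℕ) : coarsen L 0 y = y := by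
  funext i; simp [coarsen]

/-- TOWER LAW: coarsening by `n` and then by `n'` is coarsening by `n + n'`. [folklore] -/
theorem coarsen_coarsen (L n n' : ℕ) {d : ℕ} (y : Fin d → ℕ) :
    coarsen L n' (coarsen L n y) = coarsen L (n + n') y := by
  funext i; simp [coarsen, Nat.div_div_eq_div_mul, pow_add]

/-- The BOX of `j`-blocks under the `k`-block `y` (`n = k − j` coarsening steps): `Π_i [y_i·L^n, (y_i+1)·L^n)`.
[folklore] -/
def box (L n : ℕ) {d : ℕ} (y : Fin d → ℕ) : Finset (Fin d → ℕ) :=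
  Fintype.piFinset fun i => Ico (y i * L ^ n) ((y i + 1) * L ^ n)

/-- For `0 < L`, `x` coarsens to `y` iff `x` lies in the box under `y`. [folklore] -/
theorem coarsen_eq_iff_mem_box {L : ℕ} (hL : 0 < L) (n : ℕ) {d : ℕ} (x y : Fin d → ℕ) :
    coarsen L n x = y ↔ x ∈ box L n y := by
  have hp : 0 < L ^ n := pow_pos hL n
  rw [box, Fintype.mem_piFinset]
  constructor
  · intro h i
    have hi : x i / L ^ n = y i := by rw [← h]; rfl
    rw [mem_Ico]
    refine ⟨(Nat.le_div_iff_mul_le hp).1 hi.symm.le, (Nat.div_lt_iff_lt_mul hp).1 ?_⟩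
    rw [hi]; exact Nat.lt_succ_self _
  · intro h
    funext i
    have hi := mem_Ico.1 (h i)
    simp only [coarsen]
    refine le_antisymm ?_ ((Nat.le_div_iff_mul_le hp).2 hi.1)
    exact Nat.lt_succ_iff.1 ((Nat.div_lt_iff_lt_mul hp).2 hi.2)

/-- The box under a block has exactly `(L^n)^d` points. [folklore] -/
theorem card_box (L n : ℕ) {d : ℕ} (y : Fin d → ℕ) : (box L n y).card = (L ^ n) ^ d := by
  rw [box, Fintype.card_piFinset]
  have h : ∀ i, (Ico (y i * L ^ n) ((y i + 1) * L ^ n)).card = L ^ n := fun i => by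
    rw [Nat.card_Ico, Nat.add_mul, one_mul, Nat.add_sub_cancel_left]
  simp only [h, Finset.prod_const, Finset.card_univ, Fintype.card_fin]

/-! ## §2 Counting births felt at a block -/

section Counting

variable {β : Type*} [DecidableEq β] {d : ℕ}

/-- The scale-`j` members of a finite family `S` of births FELT AT the block `y` lying `n` scales above them:
those with some domain block coarsening to `y`. [folklore] -/
def feltSet (S : Finset β) (scale : β → ℕ) (dom : β → Finset (Fin d → ℕ)) (L : ℕ) (j n : ℕ)
    (y : Fin d → ℕ) : Finset β :=
  S.filter fun b => scale b = j ∧ ∃ x ∈ dom b, coarsen L n x = y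

omit [DecidableEq β] in
/-- Membership in the felt set, unfolded. [folklore] -/
theorem mem_feltSet {S : Finset β} {scale : β → ℕ} {dom : β → Finset (Fin d → ℕ)} {L j n : ℕ}
    {y : Fin d → ℕ} {b : β} :
    b ∈ feltSet S scale dom L j n y ↔ b ∈ S ∧ scale b = j ∧ ∃ x ∈ dom b, coarsen L n x = y := by
  simp [feltSet]

omit [DecidableEq β] in
/-- **POSITIONAL COUNT.**  If every `j`-block lies in the domains of at most `m` scale-`j` births, then at most
`m · (L^n)^d` scale-`j` births are felt at a block `n` scales up (`0 < L`): the felt set is covered by the `(L^n)^d`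
fibres over the box, each of multiplicity `≤ m`. [folklore] -/
theorem card_feltSet_le {S : Finset β} {scale : β → ℕ} {dom : β → Finset (Fin d → ℕ)} {L : ℕ} (hL : 0 < L)
    {m : ℕ} (j n : ℕ) (y : Fin d → ℕ)
    (hmult : ∀ x : Fin d → ℕ, (S.filter fun b => scale b = j ∧ x ∈ dom b).card ≤ m) :
    (feltSet S scale dom L j n y).card ≤ m * (L ^ n) ^ d := by
  classical
  have hsub : feltSet S scale dom L j n y ⊆
      (box L n y).biUnion fun x => S.filter fun b => scale b = j ∧ x ∈ dom b := by
    intro b hb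
    rcases mem_feltSet.1 hb with ⟨hS, hj, x, hx, hxy⟩
    exact mem_biUnion.2 ⟨x, (coarsen_eq_iff_mem_box hL n x y).1 hxy, mem_filter.2 ⟨hS, hj, hx⟩⟩
  calc (feltSet S scale dom L j n y).card
      ≤ ((box L n y).biUnion fun x => S.filter fun b => scale b = j ∧ x ∈ dom b).card := card_le_card hsub
    _ ≤ ∑ x ∈ box L n y, (S.filter fun b => scale b = j ∧ x ∈ dom b).card := card_biUnion_le
    _ ≤ ∑ _x ∈ box L n y, m := sum_le_sum fun x _ => hmult x
    _ = m * (L ^ n) ^ d := by rw [sum_const, card_box, smul_eq_mul, mul_comm]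

/-- **BRANCH LOCALITY.**  The blocks `n` scales up at which a birth with domain `D` is felt are the coarsenings of
the blocks of `D`; there are at most `|D|` of them. [folklore] -/
theorem card_image_coarsen_le (L n : ℕ) (D : Finset (Fin d → ℕ)) :
    (D.image (coarsen L n)).card ≤ D.card := card_image_le

end Counting

/-! ## §3 The bridge to `T4TermFormat.Booking` -/

namespace Anchoring

open T4TermFormat

variable (B : T4TermFormat.Booking)

/-- An ANCHORING of a booking on the block lattice `ℕ^d` with blocking factor `L`: every birth has a finite
localisation domain of blocks of its own scale, every cube a block of its scale, and a birth felt at a cube has some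
domain block coarsening (by `cubeScale − birthScale` steps) to the cube's block.  (A structure of HYPOTHESES; which
anchoring the cell's D-terms carry is for rows O3.E-iii-b, -iii-c.) [folklore] -/
structure _root_.Literature.MathematicalPhysics.QuantumFieldTheory.Balaban1983to89.T4FeltGeometry.Anchoring
    (B : T4TermFormat.Booking) (d L : ℕ) where
  /-- localisation domain of a birth, in block coordinates of its birth scale -/
  dom : B.Birth → Finset (Fin d → ℕ)
  /-- block coordinate of a cube, at its scale -/
  center : B.Cube → (Fin d → ℕ)
  /-- felt ⇒ geometrically under: some domain block coarsens to the cube's block -/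
  felt_under : ∀ q, ∀ b ∈ B.feltAt q, ∃ x ∈ dom b, coarsen L (B.cubeScale q - B.birthScale b) x = center q

variable {B} {d L : ℕ} (A : Anchoring B d L)

/-- The scale-`j` births felt at `q` sit inside the abstract felt set over `B.births` at the cube's block.
[folklore] -/
theorem feltOfScale_subset_feltSet (q : B.Cube) (j : ℕ) :
    B.feltOfScale q j ⊆ feltSet B.births B.birthScale A.dom L j (B.cubeScale q - j) (A.center q) := by
  intro b hb
  rcases B.mem_feltOfScale.1 hb with ⟨hfelt, hj⟩
  refine mem_feltSet.2 ⟨B.mem_births b, hj, ?_⟩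
  obtain ⟨x, hx, hxy⟩ := A.felt_under q b hfelt
  exact ⟨x, hx, by rw [← hj]; exact hxy⟩

/-- **`PositionalCount` DISCHARGED.**  With blocking factor `L > 0` and per-block multiplicity `m` (every block of
scale `j` lies in the domains of at most `m` births of scale `j`), the booking satisfies
`PositionalCount (fun j k => m · (L^d)^{k−j})` — the count hypothesis of `Booking.cubeBudget_of_twoRate` with
`N₀ = m`, `Λ = L^d`. [folklore] -/
theorem positionalCount_of_anchoring (hL : 0 < L) {m : ℕ}
    (hmult : ∀ j (x : Fin d → ℕ), (B.births.filter fun b => B.birthScale b = j ∧ x ∈ A.dom b).card ≤ m) :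
    B.PositionalCount fun j k => (m : ℝ) * ((L : ℝ) ^ d) ^ (k - j) := by
  intro q j
  have h1 : (B.feltOfScale q j).card ≤ m * (L ^ (B.cubeScale q - j)) ^ d :=
    (card_le_card (A.feltOfScale_subset_feltSet q j)).trans
      (card_feltSet_le hL j (B.cubeScale q - j) (A.center q) (hmult j))
  have h2 : ((B.feltOfScale q j).card : ℝ) ≤ ((m * (L ^ (B.cubeScale q - j)) ^ d : ℕ) : ℝ) := by
    exact_mod_cast h1
  refine h2.trans (le_of_eq ?_)
  push_cast
  rw [← pow_mul, ← pow_mul, mul_comm (B.cubeScale q - j) d]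

/-- **`BranchLocal` DISCHARGED.**  If cubes of one scale have distinct blocks and every domain has at most `m₀`
blocks, a birth is felt at at most `m₀` cubes of each scale. [folklore] -/
theorem branchLocal_of_anchoring {m₀ : ℕ}
    (center_inj : ∀ q q' : B.Cube, B.cubeScale q = B.cubeScale q' → A.center q = A.center q' → q = q')
    (hdom : ∀ b, (A.dom b).card ≤ m₀) : B.BranchLocal m₀ := by
  classical
  intro b k
  set T := B.cubes.filter fun q => B.cubeScale q = k ∧ b ∈ B.feltAt q with hT
  have hmaps : ∀ q ∈ T, A.center q ∈ (A.dom b).image (coarsen L (k - B.birthScale b)) := by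
    intro q hq
    rcases (mem_filter.1 hq).2 with ⟨hk, hb⟩
    obtain ⟨x, hx, hxy⟩ := A.felt_under q b hb
    exact mem_image.2 ⟨x, hx, by rw [← hk]; exact hxy⟩
  have hinj : Set.InjOn A.center (T : Set B.Cube) := by
    intro q hq q' hq' h
    have hk : B.cubeScale q = k := ((mem_filter.1 (Finset.mem_coe.1 hq)).2).1
    have hk' : B.cubeScale q' = k := ((mem_filter.1 (Finset.mem_coe.1 hq')).2).1
    exact center_inj q q' (hk.trans hk'.symm) h
  calc T.card ≤ ((A.dom b).image (coarsen L (k - B.birthScale b))).card :=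
        card_le_card_of_injOn A.center hmaps hinj
    _ ≤ (A.dom b).card := card_image_le
    _ ≤ m₀ := hdom b

/-- The two discharged shadows feed `Booking.cubeBudget_of_twoRate` directly: with sizes
`σ j k ≤ A·φ^{k−j}·τ^{K−j}` and `L^d·φ·τ ≤ 1` the booking meets the per-cube budget `(m·A)·W`.  (Which `φ, τ` the
cell's terms afford is rows O3.E-iii-b, -iii-c; nothing printed is asserted.) [folklore] -/
theorem cubeBudget_of_anchoring (hL : 0 < L) {m : ℕ}
    (hmult : ∀ j (x : Fin d → ℕ), (B.births.filter fun b => B.birthScale b = j ∧ x ∈ A.dom b).card ≤ m)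
    {σ : ℕ → ℕ → ℝ} {w : ℕ → ℝ} {A' φ τ W : ℝ} (hw : ∀ j ≤ B.K, 0 ≤ w j)
    (hW : ∑ j ∈ range (B.K + 1), w j ≤ W) (hσ : B.SizeBound σ) (hσ0 : ∀ j k, 0 ≤ σ j k) (hA : 0 ≤ A')
    (hφ : 0 ≤ φ) (hτ0 : 0 ≤ τ) (hτ1 : τ ≤ 1) (hprod : (L : ℝ) ^ d * φ * τ ≤ 1)
    (hσle : ∀ j k, j ≤ k → k ≤ B.K → σ j k ≤ A' * φ ^ (k - j) * τ ^ (B.K - j)) :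
    B.CubeBudget w (((m : ℝ) * A') * W) :=
  B.cubeBudget_of_twoRate hw hW (A.positionalCount_of_anchoring hL hmult) hσ hσ0 (Nat.cast_nonneg m) hA
    (pow_nonneg (Nat.cast_nonneg L) d) hφ hτ0 hτ1 hprod (fun _ _ _ _ => le_rfl) hσle

end Anchoring

/-! ## §4 Sanity: a concrete box -/

/-- In `d = 2` with `L = 2`, the `1`-fold box under the block `(1, 0)` is `{2,3} × {0,1}` — four points. [folklore] -/
example : (box 2 1 (![1, 0] : Fin 2 → ℕ)).card = 4 := by
  rw [card_box]; norm_num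

end Literature.MathematicalPhysics.QuantumFieldTheory.Balaban1983to89.T4FeltGeometry
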